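import Literature.Dynamics.NBody.AlbouyKaloshin2012SymmetricCCs
import Literature.Dynamics.NBody.AlbouyKaloshin2012SymmetricCCs34
import Mathlib.Tactic
import HarnessLib

/-!
# All reflection-symmetric positive normalized CCs of `(1,1,b,b,c)`, `b, c` generic: classification and finiteness frame

Topic `Literature/Dynamics/NBody`; `pub-smale6` cell, seat 1 gen 3. A reflection symmetry of a configuration
`q` with masses `m` is a line reflection `R` permuting the bodies with their masses: `∀ k ∃ l, m_l = m_k ∧ R(q_k) = q_l`
(`reflSymmCCs m`). For `m = (1,1,b,b,c)` with `b ≠ 1`, `c ≠ 1`, `b ≠ c` the induced permutation is one of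
`id`, (1 2), (3 4), (1 2)(3 4) (`reflSymmCCs_subset_union`; `R` is an involution and the positions are pairwise
distinct), so `reflSymmCCs (1,1,b,b,c)` is the union of

* the identity type `reflSymmIdCCs b c` — every body on the mirror; by the normalization of [AlbouyKaloshin2012]
  Definition 1 and the centre of mass these are the COLLINEAR configurations on the `x`-axis
  (`reflSymmIdCCs_subset_collinear`), finite in number by Moulton's theorem (1910) — NOT formalised here, kept as
  the hypothesis `(collinearXCCs m).Finite`;
* the types (1 2), (3 4), (1 2)(3 4) of `AlbouyKaloshin2012SymmetricCCs.lean` / `…SymmetricCCs34.lean`, finite under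
  finiteness of the branch systems `T12(b,c) ++++, +++-`, `T12(1/b,c/b) ++++, +++-`, `T1234(b,c) ++`.

`reflSymmCCs_finite` assembles this. For the Roberts masses `(1,1,1,1,1/4)` (`b = 1`, not generic) only the partial
statement `roberts_fourTypes_finite` is recorded: the four types above are finite under Moulton + the THREE branch
systems `T12(1,1/4) ++++`, `+++-`, `T1234(1,1/4) ++`; the six further involutions of the four unit masses
((1 3), (1 4), (2 3), (2 4), (1 3)(2 4), (1 4)(2 3)) are relabellings of these types but restoring the normalization
`y₁ = y₂` needs a general rotation, which is not carried out here.
-/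

namespace Literature.Dynamics.NBody

/-- The `y`-component of the centre-of-mass identity for the masses `(1,1,b,b,c)`. [folklore] -/
theorem e32_sum_y_eq_zero {b c : ℝ} {q : Fin 5 → ℝ × ℝ}
    (h : IsPositiveNormalizedCC (e32Masses b c) q) :
    (q 0).2 + (q 1).2 + b * (q 2).2 + b * (q 3).2 + c * (q 4).2 = 0 := by
  have h0 := congrArg Prod.snd (centerOfMass_eq_zero h)
  rw [Fin.sum_univ_five] at h0
  have e0 : e32Masses b c 0 = 1 := rfl
  have e1 : e32Masses b c 1 = 1 := rfl
  have e2 : e32Masses b c 2 = b := rfl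
  have e3 : e32Masses b c 3 = b := rfl
  have e4 : e32Masses b c 4 = c := rfl
  rw [e0, e1, e2, e3, e4] at h0
  simp only [Prod.snd_add, Prod.smul_snd, smul_eq_mul, one_mul, Prod.snd_zero] at h0
  linarith

/-- A line reflection (`a² + β² = 1`) is an involution. [folklore] -/
theorem reflLine_reflLine {a β : ℝ} (hab : a ^ 2 + β ^ 2 = 1) (d : ℝ) (p : ℝ × ℝ) :
    reflLine a β d (reflLine a β d p) = p := by
  refine Prod.ext ?_ ?_
  · simp only [reflLine]
    linear_combination (4 * a * (a * p.1 + β * p.2 - d)) * hab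
  · simp only [reflLine]
    linear_combination (4 * β * (a * p.1 + β * p.2 - d)) * hab

/-- In a normalized configuration (`y₁ = y₂`, bodies distinct) a mirror containing bodies 1 and 2 is horizontal:
`a = 0`. [folklore] -/
theorem mirror_horizontal_of_fix01 {m : Fin 5 → ℝ} {q : Fin 5 → ℝ × ℝ} (hq : IsPositiveNormalizedCC m q)
    {a β d : ℝ} (hab : a ^ 2 + β ^ 2 = 1) (h0 : reflLine a β d (q 0) = q 0)
    (h1 : reflLine a β d (q 1) = q 1) : a = 0 := by
  have hy : (q 1).2 = (q 0).2 := by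
    have := hq.2.2 (by norm_num) (by norm_num); simpa using this
  have hne : q 0 ≠ q 1 := hq.1 0 1 (by decide)
  have hx0 := congrArg Prod.fst h0
  have hy0 := congrArg Prod.snd h0
  have hx1 := congrArg Prod.fst h1
  have hy1 := congrArg Prod.snd h1
  simp only [reflLine] at hx0 hy0 hx1 hy1
  have ht0 : a * (q 0).1 + β * (q 0).2 - d = 0 := by
    linear_combination (-(1:ℝ)/2 * a) * hx0 + (-(1:ℝ)/2 * β) * hy0 -
      (a * (q 0).1 + β * (q 0).2 - d) * hab
  have ht1 : a * (q 1).1 + β * (q 1).2 - d = 0 := by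
    linear_combination (-(1:ℝ)/2 * a) * hx1 + (-(1:ℝ)/2 * β) * hy1 -
      (a * (q 1).1 + β * (q 1).2 - d) * hab
  have hprod : a * ((q 0).1 - (q 1).1) = 0 := by linear_combination ht0 - ht1 + β * hy
  rcases mul_eq_zero.mp hprod with h | h
  · exact h
  · exfalso; exact hne (Prod.ext (by linarith) hy.symm)

/-- Collinear positive normalized central configurations on the `x`-axis (the Moulton configurations in the
normalization of [AlbouyKaloshin2012] Definition 1). [folklore] -/
def collinearXCCs {n : ℕ} (m : Fin n → ℝ) : Set (Fin n → ℝ × ℝ) :=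
  {q | IsPositiveNormalizedCC m q ∧ ∀ k, (q k).2 = 0}

/-- Identity-type reflection symmetry: some line reflection fixes every body. [folklore] -/
def reflSymmIdCCs (b c : ℝ) : Set (Fin 5 → ℝ × ℝ) :=
  {q | IsPositiveNormalizedCC (e32Masses b c) q ∧ ∃ a β d : ℝ, a ^ 2 + β ^ 2 = 1 ∧
    ∀ k, reflLine a β d (q k) = q k}

/-- Identity-type symmetric CCs of `(1,1,b,b,c)` (`2 + 2b + c ≠ 0`) are collinear on the `x`-axis. [folklore] -/
theorem reflSymmIdCCs_subset_collinear {b c : ℝ} (hM : 2 + 2 * b + c ≠ 0) :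
    reflSymmIdCCs b c ⊆ collinearXCCs (e32Masses b c) := by
  rintro q ⟨hcc, a, β, d, hab, hfix⟩
  have ha := mirror_horizontal_of_fix01 hcc hab (hfix 0) (hfix 1)
  subst ha
  have hβ : β ^ 2 = 1 := by simpa using hab
  have hyk : ∀ k, (q k).2 = β * d := by
    intro k
    have h := congrArg Prod.snd (hfix k)
    simp only [reflLine] at h
    linear_combination (-(1:ℝ)/2) * h + (-(q k).2) * hβ
  have hsum := e32_sum_y_eq_zero hcc
  rw [hyk 0, hyk 1, hyk 2, hyk 3, hyk 4] at hsum
  have hβd : β * d = 0 := by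
    have : β * d * (2 + 2 * b + c) = 0 := by linear_combination hsum
    rcases mul_eq_zero.mp this with h | h
    · exact h
    · exact absurd h hM
  exact ⟨hcc, fun k => by rw [hyk k, hβd]⟩

/-- All reflection-symmetric positive normalized CCs of the masses `m`: a line reflection permuting the bodies
together with their masses. [folklore] -/
def reflSymmCCs (m : Fin 5 → ℝ) : Set (Fin 5 → ℝ × ℝ) :=
  {q | IsPositiveNormalizedCC m q ∧ ∃ a β d : ℝ, a ^ 2 + β ^ 2 = 1 ∧
    ∀ k, ∃ l, m l = m k ∧ reflLine a β d (q k) = q l}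

/-- Classification for generic `(1,1,b,b,c)` (`b ≠ 1`, `c ≠ 1`, `b ≠ c`): a reflection symmetry is of type `id`,
(1 2), (3 4) or (1 2)(3 4). [folklore] -/
theorem reflSymmCCs_subset_union {b c : ℝ} (hb1 : b ≠ 1) (hc1 : c ≠ 1) (hbc : b ≠ c) :
    reflSymmCCs (e32Masses b c) ⊆
      reflSymmIdCCs b c ∪ reflSymm12CCs b c ∪ reflSymm34CCs b c ∪ reflSymm1234CCs b c := by
  rintro q ⟨hcc, a, β, d, hab, h⟩
  have m1 : ∀ l : Fin 5, e32Masses b c l = 1 → l = 0 ∨ l = 1 := by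
    intro l; fin_cases l <;> simp [e32Masses, hb1, hc1]
  have mb : ∀ l : Fin 5, e32Masses b c l = b → l = 2 ∨ l = 3 := by
    intro l; fin_cases l <;> simp [e32Masses, hb1.symm, hbc.symm]
  have mc : ∀ l : Fin 5, e32Masses b c l = c → l = 4 := by
    intro l; fin_cases l <;> simp [e32Masses, hc1.symm, hbc]
  have invol := reflLine_reflLine hab d
  have bad : ∀ x y : ℝ × ℝ, reflLine a β d x = y → reflLine a β d y = y → x = y :=
    fun x y hx hy => by rw [← invol x, hx, hy]
  have bad' : ∀ x y : ℝ × ℝ, reflLine a β d x = x → reflLine a β d y = x → y = x :=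
    fun x y hx hy => by rw [← invol y, hy, hx]
  obtain ⟨l0, hm0, h0⟩ := h 0
  obtain ⟨l1, hm1, h1⟩ := h 1
  obtain ⟨l2, hm2, h2⟩ := h 2
  obtain ⟨l3, hm3, h3⟩ := h 3
  obtain ⟨l4, hm4, h4⟩ := h 4
  have e0 : e32Masses b c 0 = 1 := rfl
  have e1 : e32Masses b c 1 = 1 := rfl
  have e2 : e32Masses b c 2 = b := rfl
  have e3 : e32Masses b c 3 = b := rfl
  have e4 : e32Masses b c 4 = c := rfl
  rw [e0] at hm0; rw [e1] at hm1; rw [e2] at hm2; rw [e3] at hm3; rw [e4] at hm4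
  obtain rfl := mc l4 hm4
  have d01 : q 0 ≠ q 1 := hcc.1 0 1 (by decide)
  have d23 : q 2 ≠ q 3 := hcc.1 2 3 (by decide)
  rcases m1 l0 hm0 with rfl | rfl <;> rcases m1 l1 hm1 with rfl | rfl
  · exact absurd (bad' (q 0) (q 1) h0 h1).symm d01
  · -- bodies 0, 1 fixed
    rcases mb l2 hm2 with rfl | rfl <;> rcases mb l3 hm3 with rfl | rfl
    · exact absurd (bad' (q 2) (q 3) h2 h3).symm d23
    · left; left; left
      exact ⟨hcc, a, β, d, hab, fun k => by fin_cases k <;> assumption⟩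
    · left; right
      exact ⟨hcc, a, β, d, hab, h0, h1, h2, h4⟩
    · exact absurd (bad (q 2) (q 3) h2 h3) d23
  · -- bodies 0, 1 exchanged
    rcases mb l2 hm2 with rfl | rfl <;> rcases mb l3 hm3 with rfl | rfl
    · exact absurd (bad' (q 2) (q 3) h2 h3).symm d23
    · left; left; right
      exact ⟨hcc, a, β, d, hab, h0, h2, h3, h4⟩
    · right
      exact ⟨hcc, a, β, d, hab, h0, h2, h4⟩
    · exact absurd (bad (q 2) (q 3) h2 h3) d23
  · exact absurd (bad (q 0) (q 1) h0 h1) d01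

/-- **Finiteness frame, generic `(1,1,b,b,c)`.** With `b > 0`, `b ≠ 1`, `c ≠ 1`, `b ≠ c`, `2 + 2b + c ≠ 0`: if the
collinear normalized CCs are finite in number (Moulton 1910, assumed) and the five branch systems
`T12(b,c) ++++, +++-`, `T12(1/b,c/b) ++++, +++-`, `T1234(b,c) ++` have finitely many solutions, then
`(1,1,b,b,c)` has finitely many reflection-symmetric positive normalized central configurations. [folklore] -/
theorem reflSymmCCs_finite {b c : ℝ} (hb : 0 < b) (hb1 : b ≠ 1) (hc1 : c ≠ 1) (hbc : b ≠ c)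
    (hM : 2 + 2 * b + c ≠ 0) (hcol : (collinearXCCs (e32Masses b c)).Finite)
    (hA : (t12BranchSet 1 1 1 1 b c).Finite) (hB : (t12BranchSet 1 1 1 (-1) b c).Finite)
    (hA' : (t12BranchSet 1 1 1 1 b⁻¹ (c * b⁻¹)).Finite)
    (hB' : (t12BranchSet 1 1 1 (-1) b⁻¹ (c * b⁻¹)).Finite)
    (hC : (t1234BranchSet 1 1 b c).Finite) : (reflSymmCCs (e32Masses b c)).Finite :=
  ((((hcol.subset (reflSymmIdCCs_subset_collinear hM)).union (reflSymm12CCs_finite_of_two hM hA hB)).union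
    (reflSymm34CCs_finite_of_two hb hM hA' hB')).union (reflSymm1234CCs_finite_of_one hM hC)).subset
    (reflSymmCCs_subset_union hb1 hc1 hbc)

/-- **Roberts masses `(1,1,1,1,1/4)`, four symmetry types.** The identity-, (1 2)-, (3 4)- and (1 2)(3 4)-type
reflection-symmetric positive normalized CCs are finite in number provided the collinear ones are (Moulton 1910,
assumed) and the THREE branch systems `T12(1,1/4) ++++`, `T12(1,1/4) +++-`, `T1234(1,1/4) ++` have finitely many
solutions (the cell computes Gröbner bases of these modulo primes only — evidence, not proof). The six further
involution types of the four unit masses are not treated here. [folklore] -/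
theorem roberts_fourTypes_finite (hcol : (collinearXCCs (e32Masses 1 (1 / 4))).Finite)
    (hA : (t12BranchSet 1 1 1 1 1 (1 / 4)).Finite) (hB : (t12BranchSet 1 1 1 (-1) 1 (1 / 4)).Finite)
    (hC : (t1234BranchSet 1 1 1 (1 / 4)).Finite) :
    (reflSymmIdCCs 1 (1 / 4) ∪ reflSymm12CCs 1 (1 / 4) ∪ reflSymm34CCs 1 (1 / 4) ∪
      reflSymm1234CCs 1 (1 / 4)).Finite :=
  (((hcol.subset (reflSymmIdCCs_subset_collinear (by norm_num))).union
    (roberts_reflSymm12CCs_finite_of_two hA hB)).union (roberts_reflSymm34CCs_finite_of_two hA hB)).union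
    (roberts_reflSymm1234CCs_finite_of_one hC)

end Literature.Dynamics.NBody
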